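import Summits.BirchSwinnertonDyer.BirchSwinnertonDyer.Theorems.CMKolyvaginAtInertTwoLowerLevelTwoEngineAtTwo
import Summits.BirchSwinnertonDyer.BirchSwinnertonDyer.Theorems.GenusKolyvaginAtTwoGenusPrimitiveSupplyAtTwoPrimeHeegnerTwin
import Summits.BirchSwinnertonDyer.BirchSwinnertonDyer.Theorems.GenusKolyvaginAtTwoGenusPrimitiveSupplyAtTwoTwistSelmerTransferDownRat
import HarnessLib

/-!
# Route `CMKolyvaginAtInertTwo`, crux `CMKolyvaginExactAtInertTwo` (stmt-BirchSwinnertonDyer-24277), `stub_lower` — W-UP on H₂,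
# FILE W4c′: THE GENUS PLACE OF A PRIME HEEGNER FIELD (`#H¹(ℚ_q, E[2]) ≤ 4`) AND THE KUMMER MEMBERSHIP OVER `ℚ` OF A DESCENDED CLASS

Seat `bsd-line-cmk2-p1` g19 (cell `bsd-print-cf2`), `--supports stmt-BirchSwinnertonDyer-24277` (helper; closes nothing).
THEOREMS ONLY (no definition, no named fact, no `sorry`).  BSD is NOT proved by any of this; the crux is not closed here.

Two inputs of the level-`2` engine (file W3b `false_of_levelTwo_engine`) discharged on the habitat:
* `natCard_localH1_two_le_four_of_discr_eq_neg_prime` — at the genus place `u` of `K = ℚ(√−q)` (`q` prime, `d_K` odd, Heegner for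
  `N_E`, `Δ(E) < 0`): `#H¹(ℚ_u, E[2]) = (#E(ℚ_q)[2] · #(ℤ_q/2))² = 4` (Tate's local Euler characteristic
  `natCard_galoisCohomology_one_torsion_adicCompletion_eq_sq`, gk2-p5's `natCard_twoTorsion_padic_eq_two_of_discr_eq_neg_prime`,
  transported by `natCard_ker_nsmul_adicCompletion_eq_padic`).
* `mem_kummerOutside_two_of_resTorsion` — a class `Z ∈ H¹(ℚ, E[2])` whose restriction to `K` is Selmer at the places over every
  `v ∉ T` lies in `H¹_{𝓛,⊤ on T}(ℚ, E[2])` as soon as `T` contains the genus place: archimedean condition from `Δ < 0` (g8's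
  `mem_selmerLocalKer_infinitePlace_of_Δ_neg`), finite places by the displayed descent plumbing `hdesc` (ty2's `hdescfin_two_pow_one`).

References: [MilneADT2006] I Thm. 2.8, I.3.8; [Kramer1981] Prop. 3; [GrossLMS1991] §1.
-/

set_option autoImplicit false
-- the Theorems namespace of this sub repeats the summit name by design (D-0017 nested layout)
set_option linter.dupNamespace false

noncomputable section

open scoped Classical

open Field NumberField IsDedekindDomain Function WeierstrassCurve Rat.HeightOneSpectrum
open Literature.NumberTheory.EllipticCurves
open Literature.NumberTheory.GaloisRepresentations
open Literature.NumberTheory.GaloisCohomology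
open Summit.BirchSwinnertonDyer.Rank1Residual.X11b.Relaxation
open Summit.BirchSwinnertonDyer.BirchSwinnertonDyer.Theorems.GenusExact
open Summit.BirchSwinnertonDyer.BirchSwinnertonDyer.Theorems.GenusExact.RelaxedCount
open Summit.BirchSwinnertonDyer.BirchSwinnertonDyer.Theorems.GenusExact.VisiblePairAtTwo (natCast_mem_primesEquiv_symm)

namespace Summit.BirchSwinnertonDyer.BirchSwinnertonDyer.Theorems.KolyvaginLowerTwo

variable (W : WeierstrassCurve ℚ) [W.IsElliptic] [W.IsGloballyMinimal]

/-- **`#H¹(ℚ_u, E[2]) ≤ 4` at the genus place of a prime Heegner field.**  `E/ℚ` globally minimal with `Δ < 0`; `K` imaginary quadratic,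
`d_K = −q` odd, `q` prime, Heegner for `N_E`; `u` the place of `ℚ` over `q`.  Then `#H¹(ℚ_u, E[2]) = (#E(ℚ_u)[2] · #(ℤ_u/2ℤ_u))² = 4`.
[cite: MilneADT2006, Ch. I, Thm. 2.8] [cite: Kramer1981, Prop. 3] -/
theorem natCard_localH1_two_le_four_of_discr_eq_neg_prime (hΔ : W.Δ < 0) {K : Type} [Field K] [NumberField K]
    (hK : IsImaginaryQuadratic K) (hodd : Odd (NumberField.discr K)) (hHe : SatisfiesHeegnerHypothesis (W.conductorNorm ℤ) K)
    {q : ℕ} (hq : q.Prime) (hdq : NumberField.discr K = -(q : ℤ)) (u : HeightOneSpectrum (𝓞 ℚ))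
    (hu : ((primesEquiv u : Nat.Primes) : ℕ) = q) :
    Nat.card (galoisCohomology ((W.torsionGaloisModule ((2 ^ 1 : ℕ) : ℤ)).toLocal (Sum.inr u : Place ℚ)) 1) ≤ 4 := by
  haveI : Fact q.Prime := ⟨hq⟩
  have hqu : (q : 𝓞 ℚ) ∈ u.asIdeal := by rw [← hu]; exact natCast_natGenerator_mem u
  have hq2 : q ≠ 2 := fun h ↦ by
    rw [hdq, h] at hodd; exact (Int.not_even_iff_odd.mpr hodd) ⟨-1, by norm_num⟩
  have h2u : ((2 : ℕ) : 𝓞 ℚ) ∉ u.asIdeal := LocalDualityOrder.two_notMem_of_odd_prime_mem hq2 hqu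
  have hpp : IsPrimePow (2 ^ 1) := ⟨2, 1, Nat.prime_two.prime, one_pos, rfl⟩
  have hE : Nat.card (galoisCohomology ((W.torsionGaloisModule ((2 ^ 1 : ℕ) : ℤ)).toLocal (Sum.inr u : Place ℚ)) 1) =
      (Nat.card (nsmulAddMonoidHom (2 ^ 1) : (W.baseChange (u.adicCompletion ℚ)).toAffine.Point →+ _).ker *
        Nat.card (u.adicCompletionIntegers ℚ ⧸ Ideal.span {((2 ^ 1 : ℕ) : u.adicCompletionIntegers ℚ)})) ^ 2 := by
    haveI : CharZero (u.adicCompletion ℚ) := charZero_adicCompletion u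
    exact natCard_galoisCohomology_one_torsion_adicCompletion_eq_sq W u (2 ^ 1) hpp (localEulerPoincareCharacteristic_holds _)
  rw [hE, LocalDualityOrder.natCard_quotient_span_natCast_eq_one u (LocalDualityOrder.natCast_pow_notMem u h2u 1), mul_one,
    GenusKolyTwistLocal.natCard_ker_nsmul_adicCompletion_eq_padic W u (2 ^ 1)]
  -- the two-torsion count at the genus place, transported from `ℚ_q` (gk2-p5), via a `subst`-able copy of `hu`
  have aux : ∀ (q' : ℕ) (hq' : q'.Prime), NumberField.discr K = -(q' : ℤ) → ((primesEquiv u : Nat.Primes) : ℕ) = q' →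
      haveI := Fact.mk (primesEquiv u).2
      Nat.card {Q : (W.baseChange ℚ_[((primesEquiv u : Nat.Primes) : ℕ)]).toAffine.Point // (2 ^ 1) • Q = 0} = 2 := by
    intro q' hq' hd' hu'
    subst hu'
    haveI : Fact (Nat.Prime ((primesEquiv u : Nat.Primes) : ℕ)) := ⟨hq'⟩
    simp only [pow_one]
    exact GenusKolyTwin.natCard_twoTorsion_padic_eq_two_of_discr_eq_neg_prime W hK hodd hHe hd' hΔ
  rw [aux q hq hdq hu]
  norm_num

omit [W.IsGloballyMinimal] in
/-- **Kummer membership over `ℚ` of a class with Selmer restriction.**  `E/ℚ` with `Δ < 0` (so `H¹(ℝ, E[2])` imposes nothing), the descent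
plumbing `hdesc` off the genus place `u`, `T ∋ u` a finite set of places: if `res_K Z` is Selmer at the places of `K` over every finite
`v ∉ T`, then `Z ∈ H¹_{𝓛,⊤ on T}(ℚ, E[2])`. [cite: MilneADT2006, Ch. I, §3.8 and §6] [cite: GrossLMS1991, §1] -/
theorem mem_kummerOutside_two_of_resTorsion (hΔ : W.Δ < 0) {K : Type} [Field K] [NumberField K]
    (u : HeightOneSpectrum (𝓞 ℚ))
    (hdesc : ∀ (ξ : galH1Torsion W ((2 ^ 1 : ℕ) : ℤ)) (v : HeightOneSpectrum (𝓞 ℚ)), v ≠ u →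
      (∀ w : HeightOneSpectrum (𝓞 K), w.under (𝓞 ℚ) = v →
        resTorsion W K ((2 ^ 1 : ℕ) : ℤ) ξ ∈ selmerLocalKer (W.baseChange K) (w.adicCompletion K) ((2 ^ 1 : ℕ) : ℤ)) →
      ξ ∈ selmerLocalKer W (v.adicCompletion ℚ) ((2 ^ 1 : ℕ) : ℤ))
    (T : Finset (Place ℚ)) (huT : (Sum.inr u : Place ℚ) ∈ T)
    (Z : galoisCohomology (W.torsionGaloisModule ((2 ^ 1 : ℕ) : ℤ)) 1) {cZ : galH1Torsion (W.baseChange K) ((2 ^ 1 : ℕ) : ℤ)}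
    (hZ : resTorsion W K ((2 ^ 1 : ℕ) : ℤ) Z = cZ)
    (hKum : ∀ v : HeightOneSpectrum (𝓞 ℚ), (Sum.inr v : Place ℚ) ∉ T → ∀ w : HeightOneSpectrum (𝓞 K), w.under (𝓞 ℚ) = v →
      cZ ∈ selmerLocalKer (W.baseChange K) (w.adicCompletion K) ((2 ^ 1 : ℕ) : ℤ)) :
    Z ∈ kummerOutside W (2 ^ 1) T := by
  refine (mem_kummerOutside_iff W (2 ^ 1) _ _).mpr ?_
  rintro (w | v) hv
  · exact (res_mem_kummerLocalConditionAt_iff W ((2 ^ 1 : ℕ) : ℤ) (Place.Completion (Sum.inl w : Place ℚ)) _).mpr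
      (KolyvaginRatDescentTwo.mem_selmerLocalKer_infinitePlace_of_Δ_neg W hΔ w Z)
  · have hvu : v ≠ u := fun h ↦ hv (by rw [h]; exact huT)
    exact (res_mem_kummerLocalConditionAt_iff W ((2 ^ 1 : ℕ) : ℤ) (Place.Completion (Sum.inr v : Place ℚ)) _).mpr
      (hdesc Z v hvu fun w hw ↦ by rw [hZ]; exact hKum v hv w hw)

omit [W.IsElliptic] [W.IsGloballyMinimal] in
/-- **Mod `2` the Kolyvagin sign is invisible**: a `σ`-eigenclass of sign `±1` in `H¹(K, E[2])` is `σ`-fixed (`−x = x`). [folklore] -/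
theorem conjAct_eq_self_of_sign_two {K : Type} [Field K] [NumberField K] (σ : K ≃ₐ[ℚ] K)
    (x : galH1Torsion (W.baseChange K) ((2 ^ 1 : ℕ) : ℤ)) {sx : ℤ} (hsx : sx = 1 ∨ sx = -1)
    (hx : conjAct W σ ((2 ^ 1 : ℕ) : ℤ) x = sx • x) : conjAct W σ ((2 ^ 1 : ℕ) : ℤ) x = x := by
  rcases hsx with rfl | rfl
  · rw [hx, one_zsmul]
  · rw [hx, neg_one_zsmul, neg_eq_iff_add_eq_zero, ← two_zsmul]
    exact_mod_cast zsmul_discreteH1_torsion _ x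

omit [W.IsElliptic] [W.IsGloballyMinimal] in
/-- **A non-zero class of `H¹(K, E[2])` has order exactly `2`.** [folklore] -/
theorem addOrderOf_eq_two_pow_one_of_ne_zero {K : Type} [Field K] [NumberField K]
    {x : galH1Torsion (W.baseChange K) ((2 ^ 1 : ℕ) : ℤ)} (hx : x ≠ 0) : addOrderOf x = 2 ^ 1 := by
  have hdvd : addOrderOf x ∣ 2 ^ 1 := by
    rw [addOrderOf_dvd_iff_nsmul_eq_zero, ← natCast_zsmul]
    exact zsmul_discreteH1_torsion _ _
  obtain ⟨k, hk1, hk⟩ := (Nat.dvd_prime_pow Nat.prime_two).mp hdvd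
  have hk0 : k ≠ 0 := fun h0 ↦ by
    rw [h0, pow_zero, AddMonoid.addOrderOf_eq_one_iff] at hk
    exact hx hk
  have hk' : k = 1 := by omega
  rw [hk, hk']

end Summit.BirchSwinnertonDyer.BirchSwinnertonDyer.Theorems.KolyvaginLowerTwo

end
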